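import Literature.NumberTheory.Automorphic.OrdinaryCompletedCohomologyGL
import Mathlib.NumberTheory.Padics.Complex
import HarnessLib

/-!
# Continuous points of the Hecke algebras of the Hida tower are integral

Topic `NumberTheory/Automorphic`; namespaces `Literature.NumberTheory.Automorphic` (generic part)
and `Literature.NumberTheory.Automorphic.BigHeckeGLn.TameLevel`; theorems only.  Proof file
supporting the named fact `Literature.NumberTheory.Automorphic.hidaControl_dominantOrdinaryPoint`
(Hida's control theorem in consequence form, `BianchiOrdinaryClassicality`): that statement
quantifies over CONTINUOUS ring homomorphisms `x : 𝕋^{S,ord}(𝒰) → ℚ̄_p`, whereas the printed theory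
([Hida1994AIF, §3]; [KhareThorne2017, §6.5, Cor. 6.15, Lemma 6.17]) is about `𝒪`-valued points of
the big ordinary Hecke algebra.  The reduction is the following elementary fact, proved here for the
tree's model (`OrdinaryCompletedCohomologyGL`): `𝕋^{S,ord}(𝒰) ⊆ ∏_{(i,r,s)} End(H^i(X_{U(r)}, ℤ/p^s)^{ord})`
carries the subspace topology of the product of discrete rings, and `p^s = 0` in the factor at
`(i, r, s)`; hence

* `norm_apply_le_one_of_continuous_of_pow_eq_zero` (generic): a continuous ring homomorphism
  `φ : 𝕋 → A` from a subring `𝕋` of a product `∏ᵢ Rᵢ` in which `p^{sᵢ} = 0` in `Rᵢ`, to a normed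
  division ring `A` with `p ≠ 0`, satisfies `‖φ t‖ ≤ 1` for all `t`: a basic neighbourhood
  `{t : tᵢ = 0, i ∈ I}` (`I` finite) of `0` mapped into the open unit ball is an ideal, so it is
  killed by `φ` as soon as some `‖φ t₀‖ > 1` (`‖φ t₀‖ⁿ ‖φ t‖ < 1` for all `n`); but it contains
  `p^{max sᵢ}`, and `φ(p^S) = p^S ≠ 0`.
* `groupCohomology_smul_eq_zero` (generic): a scalar killing the coefficients kills `Hⁿ(G, A)`;
  whence `TameLevel.pow_smul_hidaCohomology_eq_zero` (`p^s · H^i(X_{U(r)}, ℤ/p^s) = 0`) and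
  `natCast_pow_ordEndFactor_eq_zero`, `natCast_pow_hidaEndFactor_eq_zero` (`p^s = 0` in the factors).
* **`OrdinaryHeckeAlgebraGLn.norm_apply_le_one`**, **`HidaHeckeAlgebraGLn.norm_apply_le_one`**: every
  continuous point of `𝕋^{S,ord}(𝒰)` or `𝕋^S(𝒰; p)` with values in a normed division ring of
  characteristic zero (e.g. `ℚ̄_p = PadicAlgCl p`, a finite extension `E/ℚ_p`, `ℂ_p`) is INTEGRAL:
  `‖x t‖ ≤ 1` — so `x` is a point of `𝕋` with values in the valuation ring, as in the sources.

## References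

* H. Hida, *p-adic ordinary Hecke algebras for GL(2)*, Ann. Inst. Fourier 44 (1994), §3
  (points of `h^{n.ord}` with values in `p`-adic integer rings; held, read 2026-08-16). [Hida1994AIF]
* C. Khare, J. A. Thorne, *Potential automorphy and the Leopoldt conjecture*, Amer. J. Math. 139
  (2017), §6.5 (arXiv:1409.7007, held; read 2026-08-16). [KhareThorne2017]
-/

noncomputable section

open CategoryTheory

namespace Literature.NumberTheory.Automorphic

/-! ### Scalars killing the coefficients kill group cohomology -/

section Torsion

universe u

variable {k G : Type u} [CommRing k] [Group G]

/-- If `r ∈ k` kills the representation `A` (`r • a = 0` for all `a`), then `r` kills every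
`Hⁿ(G, A)` (cocycles are functions with values in `A`). [folklore] -/
theorem groupCohomology_smul_eq_zero (A : Rep k G) {r : k} (hr : ∀ a : A, r • a = 0) (n : ℕ)
    (x : groupCohomology A n) : r • x = 0 := by
  induction x using groupCohomology_induction_on with
  | h z =>
    have hz : r • z = 0 := by
      apply (ModuleCat.mono_iff_injective (groupCohomology.iCocycles A n)).1 inferInstance
      rw [map_smul, map_zero]
      exact funext fun g => hr _
    rw [← map_smul, hz, map_zero]

end Torsion

/-! ### Continuous points of subrings of products with `p`-power torsion factors -/

section Generic

/-- **A continuous point of a subring of `∏ᵢ Rᵢ`, `p^{sᵢ} Rᵢ = 0`, is integral.**  Let `𝕋` be a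
subring of a product of topological rings `Rᵢ` in which `p^{sᵢ} = 0`, with the subspace topology, and
`φ : 𝕋 → A` a continuous ring homomorphism to a normed division ring in which `p ≠ 0`.  Then
`‖φ t‖ ≤ 1` for every `t ∈ 𝕋`. [folklore] -/
theorem norm_apply_le_one_of_continuous_of_pow_eq_zero {ι : Type*} {R : ι → Type*}
    [∀ i, Ring (R i)] [∀ i, TopologicalSpace (R i)] (𝕋 : Subring (∀ i, R i)) {A : Type*}
    [NormedDivisionRing A] (φ : 𝕋 →+* A) (hφ : Continuous φ) {p : ℕ} (hp : (p : A) ≠ 0)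
    (s : ι → ℕ) (hs : ∀ i, (p : R i) ^ s i = 0) (t : 𝕋) : ‖φ t‖ ≤ 1 := by
  by_contra ht
  rw [not_le] at ht
  -- Step 1: a finite set of indices `I` with `tᵢ = 0 (i ∈ I) ⇒ ‖φ t‖ < 1`.
  obtain ⟨I, hI⟩ : ∃ I : Finset ι, ∀ T : 𝕋, (∀ i ∈ I, (T : ∀ i, R i) i = 0) → ‖φ T‖ < 1 := by
    have hopen : IsOpen ((φ : 𝕋 → A) ⁻¹' Metric.ball 0 1) := Metric.isOpen_ball.preimage hφ
    obtain ⟨U, hU, hUeq⟩ := isOpen_induced_iff.1 hopen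
    have h0 : (0 : ∀ i, R i) ∈ U := by
      have h : (0 : 𝕋) ∈ (φ : 𝕋 → A) ⁻¹' Metric.ball 0 1 := by simp
      rw [← hUeq] at h
      exact h
    obtain ⟨I, u, hu, hsub⟩ := isOpen_pi_iff.1 hU 0 h0
    refine ⟨I, fun T hT => ?_⟩
    have hTU : (T : ∀ i, R i) ∈ U := hsub (Set.mem_pi.2 fun i hi => by
      rw [hT i (Finset.mem_coe.1 hi)]
      exact (hu i (Finset.mem_coe.1 hi)).2)
    have h : T ∈ (φ : 𝕋 → A) ⁻¹' Metric.ball 0 1 := by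
      rw [← hUeq]
      exact hTU
    simpa using h
  -- Step 2: such `T` are killed by `φ` (the set is an ideal mapped into the open unit ball).
  have hker : ∀ T : 𝕋, (∀ i ∈ I, (T : ∀ i, R i) i = 0) → φ T = 0 := by
    intro T hT
    by_contra hT0
    have hpos : 0 < ‖φ T‖ := norm_pos_iff.2 hT0
    have hlt : ∀ m : ℕ, ‖φ t‖ ^ m * ‖φ T‖ < 1 := fun m => by
      have h := hI (t ^ m * T) fun i hi => by
        rw [Subring.coe_mul, Subring.coe_pow, Pi.mul_apply, Pi.pow_apply, hT i hi, mul_zero]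
      rwa [map_mul, map_pow, norm_mul, norm_pow] at h
    obtain ⟨m, hm⟩ := pow_unbounded_of_one_lt (1 / ‖φ T‖) ht
    rw [div_lt_iff₀ hpos] at hm
    exact absurd (hlt m) (not_lt.2 hm.le)
  -- Step 3: `p^S`, `S = max_{i ∈ I} sᵢ`, is such a `T`, but `φ(p^S) = p^S ≠ 0`.
  set S : ℕ := I.sup s
  have hPS : ∀ i ∈ I, (((p : 𝕋) ^ S : 𝕋) : ∀ i, R i) i = 0 := by
    intro i hi
    have hle : s i ≤ S := Finset.le_sup hi
    rw [Subring.coe_pow, Subring.coe_natCast, Pi.pow_apply, Pi.natCast_apply,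
      ← Nat.sub_add_cancel hle, pow_add, hs i, mul_zero]
  have h0 := hker _ hPS
  rw [map_pow, map_natCast] at h0
  exact pow_ne_zero S hp h0

end Generic

/-! ### The Hida tower: `p^s` kills the factors at `(i, r, s)` -/

namespace BigHeckeGLn

namespace TameLevel

variable {n : ℕ} {K : Type} [Field K] [NumberField K] {p : ℕ} [Fact p.Prime] (𝒰 : TameLevel n K p)

/-- **`p^s · H^i(X_{U(r)}, ℤ/p^s) = 0`.** [folklore] -/
theorem pow_smul_hidaCohomology_eq_zero (x : TowerIndex) (y : 𝒰.hidaCohomology ℤ x) :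
    ((p : ℤ) ^ x.2.2) • y = 0 := by
  -- (the `ℤ`-action of the `ModuleCat ℤ` structure agrees with the integer multiples, `int_smul_eq_zsmul`)
  refine (int_smul_eq_zsmul _ _ _).symm.trans (groupCohomology_smul_eq_zero _ (fun a => ?_) _ y)
  funext c
  change ((p : ℤ) ^ x.2.2) • a c = 0
  obtain ⟨m, hm⟩ := Ideal.Quotient.mk_surjective (a c)
  rw [← hm, zsmul_eq_mul, ← map_intCast (Ideal.Quotient.mk (Ideal.span {(p : ℤ) ^ x.2.2})),
    Int.cast_id, ← map_mul, Ideal.Quotient.eq_zero_iff_mem]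
  exact Ideal.mul_mem_right _ _ (Ideal.subset_span rfl)

/-- `p^s = 0` in `End(H^i(X_{U(r)}, ℤ/p^s))`, the factor of `𝕋^S(𝒰; p)` at `(i, r, s)`. [folklore] -/
theorem natCast_pow_hidaEndFactor_eq_zero (x : TowerIndex) :
    (p : 𝒰.HidaEndFactor ℤ x) ^ x.2.2 = 0 := by
  refine DFunLike.ext _ _ fun y => ?_
  rw [← Nat.cast_pow]
  change ((p ^ x.2.2 : ℕ) : Module.End ℤ (𝒰.hidaCohomology ℤ x)) y = 0
  rw [Module.End.natCast_apply, ← Nat.cast_smul_eq_nsmul ℤ, Nat.cast_pow]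
  exact (int_smul_eq_zsmul _ _ _).trans (𝒰.pow_smul_hidaCohomology_eq_zero x y)

/-- `p^s = 0` in `End(H^i(X_{U(r)}, ℤ/p^s)^{ord})`, the factor of `𝕋^{S,ord}(𝒰)` at `(i, r, s)`.
[folklore] -/
theorem natCast_pow_ordEndFactor_eq_zero (x : TowerIndex) :
    (p : 𝒰.OrdEndFactor ℤ x) ^ x.2.2 = 0 := by
  refine DFunLike.ext _ _ fun y => ?_
  rw [← Nat.cast_pow]
  change ((p ^ x.2.2 : ℕ) : Module.End ℤ (𝒰.ordinaryPart ℤ x)) y = 0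
  rw [Module.End.natCast_apply]
  refine Subtype.ext ?_
  rw [Submodule.coe_smul_of_tower, ← Nat.cast_smul_eq_nsmul ℤ, Nat.cast_pow, Submodule.coe_zero]
  exact (int_smul_eq_zsmul _ _ _).trans (𝒰.pow_smul_hidaCohomology_eq_zero x y)

end TameLevel

end BigHeckeGLn

open BigHeckeGLn

/-- **Continuous points of the ordinary big Hecke algebra are integral.**  For a tame level `𝒰` of
`GL_n/K` and a continuous ring homomorphism `x : 𝕋^{S,ord}(𝒰) → A` to a normed division ring of
characteristic zero (`ℚ̄_p`, `E/ℚ_p` finite, `ℂ_p`, …): `‖x t‖ ≤ 1` for all `t` — `x` takes values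
in the valuation ring, i.e. it is a point of `𝕋^{S,ord}(𝒰)` in the sense of [Hida1994AIF, §3] /
[KhareThorne2017, §6.5]. [folklore] -/
theorem OrdinaryHeckeAlgebraGLn.norm_apply_le_one {n : ℕ} {K : Type} [Field K] [NumberField K]
    {p : ℕ} [Fact p.Prime] {𝒰 : TameLevel n K p} {A : Type*} [NormedDivisionRing A] [CharZero A]
    (x : OrdinaryHeckeAlgebraGLn 𝒰 →+* A) (hx : Continuous x) (t : OrdinaryHeckeAlgebraGLn 𝒰) :
    ‖x t‖ ≤ 1 :=
  norm_apply_le_one_of_continuous_of_pow_eq_zero (𝒰.ordHeckeSubring ℤ) x hx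
    (Nat.cast_ne_zero.2 (Fact.out : p.Prime).ne_zero) (fun i : TowerIndex => i.2.2)
    (fun i => 𝒰.natCast_pow_ordEndFactor_eq_zero i) t

/-- **Continuous points of `𝕋^S(𝒰; p)` are integral** (same statement for the Hecke algebra of the
Hida tower before passing to ordinary parts). [folklore] -/
theorem HidaHeckeAlgebraGLn.norm_apply_le_one {n : ℕ} {K : Type} [Field K] [NumberField K]
    {p : ℕ} [Fact p.Prime] {𝒰 : TameLevel n K p} {A : Type*} [NormedDivisionRing A] [CharZero A]
    (x : HidaHeckeAlgebraGLn 𝒰 →+* A) (hx : Continuous x) (t : HidaHeckeAlgebraGLn 𝒰) :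
    ‖x t‖ ≤ 1 :=
  norm_apply_le_one_of_continuous_of_pow_eq_zero (𝒰.hidaHeckeSubring ℤ) x hx
    (Nat.cast_ne_zero.2 (Fact.out : p.Prime).ne_zero) (fun i : TowerIndex => i.2.2)
    (fun i => 𝒰.natCast_pow_hidaEndFactor_eq_zero i) t

/-- In particular for `ℚ̄_p`-valued continuous points, as in `hidaControl_dominantOrdinaryPoint`.
[folklore] -/
theorem OrdinaryHeckeAlgebraGLn.norm_apply_le_one_padicAlgCl {n : ℕ} {K : Type} [Field K]
    [NumberField K] {p : ℕ} [Fact p.Prime] {𝒰 : TameLevel n K p}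
    (x : OrdinaryHeckeAlgebraGLn 𝒰 →+* PadicAlgCl p) (hx : Continuous x)
    (t : OrdinaryHeckeAlgebraGLn 𝒰) : ‖x t‖ ≤ 1 :=
  OrdinaryHeckeAlgebraGLn.norm_apply_le_one x hx t

end Literature.NumberTheory.Automorphic
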